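import Literature.NumberTheory.Sieve.CFSemigroupPowFamily
import Mathlib.Analysis.Normed.Algebra.Exponential
import Mathlib.Analysis.SpecialFunctions.Exponential
import HarnessLib

/-!
# `CfLip` as a commutative Banach algebra; analyticity of the power families `Φ^{-z}`

Support file (all results proved) for the named fact
`Literature.NumberTheory.Sieve.MageeOhWinter2019_uniformCounting` (`CFSemigroupCounting.lean`).
The Lipschitz space `CfLip` on `[0,1]` (`CFSemigroupLipSpace.lean`) carries the pointwise product
`CfLip.mul` with `‖F G‖ ≤ ‖F‖ ‖G‖` (`CFSemigroupPowFamily.lean`). Here we register the resulting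
**commutative Banach algebra** structure (`CommRing`, `NormedCommRing`, `NormedAlgebra ℂ`; all operations
pointwise, `instMul`/`instOne`), identify the Banach-algebra exponential pointwise
(`exp_apply : (exp F)(y) = e^{F(y)}`), and deduce that the power functions of a threshold,
`z ↦ Φ^{-z} = exp(−z log Φ)` (`CfThreshold.cfPow`) and the test families `s ↦ G · Φ^{-cs}`
(`CfThreshold.cfPowFam`, e.g. `cfGfam` of the renewal theorems), are **entire `CfLip`-valued functions**
(`analyticAt_cfPow`, `analyticAt_cfPowFam`). This is the holomorphy in `s` of the `s`-dependent test
functions `g ⊗ Φ^{-2s}` of [MageeOhWinter2019, §3.1–3.4] (there implicit: "`n_q(s, x, φ')` is holomorphic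
for `s` in this region"), needed to run the contour-shift/power-saving argument with thresholds.

## References
* [MageeOhWinter2019] M. Magee, H. Oh, D. Winter, J. reine angew. Math. 753 (2019), §3.1, §3.4.
-/

noncomputable section

open Set Filter Topology

namespace Literature.NumberTheory.Sieve

namespace CfLip

/-! ### The pointwise ring structure -/

/-- Pointwise multiplication (`CfLip.mul`). [folklore] -/
instance instMul : Mul CfLip := ⟨CfLip.mul⟩

/-- The constant function `1`. [folklore] -/
instance instOne : One CfLip := ⟨CfLip.const 1⟩

/-- Natural-number constants. [folklore] -/
instance instNatCast : NatCast CfLip := ⟨fun n => CfLip.const n⟩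

/-- Integer constants. [folklore] -/
instance instIntCast : IntCast CfLip := ⟨fun n => CfLip.const n⟩

/-- Powers by iterated multiplication. [folklore] -/
instance instPow : Pow CfLip ℕ := ⟨fun F n => npowRec n F⟩

/-- Evaluation of a product. [folklore] -/
@[simp] theorem mul_apply' (F G : CfLip) (x : Icc (0 : ℝ) 1) : (F * G) x = F x * G x := rfl

/-- `F * G` is `F.mul G`. [folklore] -/
theorem mul_def (F G : CfLip) : F * G = F.mul G := rfl

/-- Evaluation of `1`. [folklore] -/
@[simp] theorem one_apply (x : Icc (0 : ℝ) 1) : (1 : CfLip) x = 1 := rfl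

/-- Evaluation of a natural-number constant. [folklore] -/
@[simp] theorem natCast_apply (n : ℕ) (x : Icc (0 : ℝ) 1) : (n : CfLip) x = n := rfl

/-- Evaluation of an integer constant. [folklore] -/
@[simp] theorem intCast_apply (n : ℤ) (x : Icc (0 : ℝ) 1) : (n : CfLip) x = n := rfl

/-- Evaluation of a power. [folklore] -/
@[simp] theorem pow_apply (F : CfLip) (n : ℕ) (x : Icc (0 : ℝ) 1) : (F ^ n) x = F x ^ n := by
  induction n with
  | zero => rfl
  | succ n ih =>
    show (npowRec (n + 1) F) x = F x ^ (n + 1)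
    rw [npowRec, pow_succ]
    show (npowRec n F) x * F x = _
    rw [show (npowRec n F) x = (F ^ n) x from rfl, ih]

/-- The coercion of a power. [folklore] -/
theorem coe_pow (F : CfLip) (n : ℕ) : ⇑(F ^ n) = (⇑F) ^ n := funext fun x => by simp

/-- **`CfLip` is a commutative ring** under pointwise operations. [folklore] -/
instance instCommRing : CommRing CfLip :=
  DFunLike.coe_injective.commRing _ coe_zero rfl (fun F G => funext fun x => add_apply F G x)
    (fun F G => funext fun x => mul_apply' F G x) (fun F => funext fun x => neg_apply F x)
    (fun F G => funext fun x => sub_apply F G x)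
    (fun n F => funext fun x => by rw [Pi.smul_apply, nsmul_apply, nsmul_eq_mul])
    (fun n F => funext fun x => by rw [Pi.smul_apply, zsmul_apply, zsmul_eq_mul]) coe_pow
    (fun n => funext fun x => natCast_apply n x) (fun n => funext fun x => intCast_apply n x)

/-- **`CfLip` is a commutative Banach algebra:** `‖F G‖ ≤ ‖F‖ ‖G‖`. [folklore] -/
instance instNormedCommRing : NormedCommRing CfLip :=
  { CfLip.instNormedAddCommGroup, CfLip.instCommRing with
    norm_mul_le := fun F G => CfLip.norm_mul_le F G }

/-- Scalars act compatibly with the product. [folklore] -/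
instance instAlgebra : Algebra ℂ CfLip :=
  Algebra.ofModule (fun c F G => CfLip.ext fun x => by simp [mul_assoc])
    (fun c F G => CfLip.ext fun x => by simp [mul_left_comm])

/-- `CfLip` is a normed `ℂ`-algebra. [folklore] -/
instance instNormedAlgebra : NormedAlgebra ℂ CfLip :=
  { CfLip.instAlgebra with norm_smul_le := fun c F => norm_smul_le c F }

/-! ### The exponential is pointwise -/

/-- **The Banach-algebra exponential of `CfLip` is the pointwise exponential:**
`(exp F)(y) = e^{F(y)}`. [folklore] -/
theorem exp_apply (F : CfLip) (y : Icc (0 : ℝ) 1) : NormedSpace.exp F y = Complex.exp (F y) := by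
  have h1 : HasSum (fun n : ℕ => ((Nat.factorial n : ℂ)⁻¹) • F ^ n) (NormedSpace.exp F) :=
    NormedSpace.exp_series_hasSum_exp' (𝕂 := ℂ) F
  have h2 : HasSum (fun n : ℕ => (((Nat.factorial n : ℂ)⁻¹) • F ^ n) y) (NormedSpace.exp F y) :=
    (CfLip.eval y).hasSum h1
  have h3 : HasSum (fun n : ℕ => ((Nat.factorial n : ℂ)⁻¹) • (F y) ^ n) (NormedSpace.exp (F y)) :=
    NormedSpace.exp_series_hasSum_exp' (𝕂 := ℂ) (F y)
  simp only [smul_apply, pow_apply, smul_eq_mul] at h2 h3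
  rw [congr_fun Complex.exp_eq_exp_ℂ (F y)]
  exact h2.unique h3

/-- `z ↦ exp(z • Ψ + Ξ)`-type maps: the exponential of `CfLip` is entire. [folklore] -/
theorem analyticAt_exp (F : CfLip) : AnalyticAt ℂ (NormedSpace.exp : CfLip → CfLip) F :=
  NormedSpace.exp_analytic F

end CfLip

/-! ### Analyticity of the power families of a threshold -/

namespace CfThreshold

variable (Θ : CfThreshold)

/-- `log Φ` as an element of `CfLip` (`|log Φ x − log Φ y| ≤ L |x − y|`). [folklore] -/
def logΦ : CfLip :=
  CfLip.mk' (fun y => (Real.log (Θ.Φ y) : ℂ)) Θ.L fun x y => by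
    rw [← Complex.ofReal_sub, Complex.norm_real, Real.norm_eq_abs]
    exact Θ.abs_log_sub_le x.2 y.2

/-- Evaluation of `logΦ`. [folklore] -/
@[simp] theorem logΦ_apply (y : Icc (0 : ℝ) 1) : Θ.logΦ y = (Real.log (Θ.Φ y) : ℂ) := rfl

/-- **`Φ^{-z} = exp(−z log Φ)` in the Banach algebra `CfLip`.** [folklore] -/
theorem cfPow_eq_exp (z : ℂ) : Θ.cfPow z = NormedSpace.exp (-(z • Θ.logΦ)) := by
  refine CfLip.ext fun y => ?_
  rw [cfPow_apply, CfLip.exp_apply, CfLip.neg_apply, CfLip.smul_apply, logΦ_apply]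

/-- **`z ↦ Φ^{-z}` is an entire `CfLip`-valued function.** [cite: MageeOhWinter2019, §3.4] -/
theorem analyticAt_cfPow (z : ℂ) : AnalyticAt ℂ Θ.cfPow z := by
  have hlin : AnalyticAt ℂ (fun z : ℂ => -(z • Θ.logΦ)) z :=
    (((ContinuousLinearMap.id ℂ ℂ).smulRight Θ.logΦ).analyticAt z).neg
  have h := AnalyticAt.comp (g := (NormedSpace.exp : CfLip → CfLip)) (f := fun z : ℂ => -(z • Θ.logΦ)) (x := z)
    (CfLip.analyticAt_exp (-(z • Θ.logΦ))) hlin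
  have heq : Θ.cfPow = fun z => NormedSpace.exp (-(z • Θ.logΦ)) := funext Θ.cfPow_eq_exp
  rw [heq]
  exact h

/-- **`s ↦ G · Φ^{-cs}` is an entire `CfLip`-valued function** (the test families `g ⊗ Φ^{-2s}`).
[cite: MageeOhWinter2019, §3.4] -/
theorem analyticAt_cfPowFam (G : CfLip) (c : ℝ) (s : ℂ) : AnalyticAt ℂ (Θ.cfPowFam G c) s := by
  have h1 : AnalyticAt ℂ (fun s : ℂ => Θ.cfPow ((c : ℂ) * s)) s :=
    (Θ.analyticAt_cfPow _).comp (analyticAt_const.mul analyticAt_id)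
  have h2 : AnalyticAt ℂ (fun s : ℂ => G * Θ.cfPow ((c : ℂ) * s)) s := analyticAt_const.mul h1
  have heq : Θ.cfPowFam G c = fun s => G * Θ.cfPow ((c : ℂ) * s) := funext fun s => rfl
  rw [heq]
  exact h2

/-- Continuity of the power family in the Banach algebra (again, from analyticity). [folklore] -/
theorem continuousAt_cfPowFam (G : CfLip) (c : ℝ) (s : ℂ) : ContinuousAt (Θ.cfPowFam G c) s :=
  (Θ.analyticAt_cfPowFam G c s).continuousAt

end CfThreshold

end Literature.NumberTheory.Sieve
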